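import Summits.QuantumFields.BalabanUV.Beta.D1BFx.WardJetsCombSources
import Summits.QuantumFields.BalabanUV.Beta.D1BFx.TorusCombKKT
import Summits.QuantumFields.BalabanUV.Beta.D1BFx.TorusGaugeBasisTranspose

/-!
# `BalabanUV.Beta.D1BFx.PackedWardLettersFirst` — road «BF-x» for binder row D1, slot (K), chain step (I) «(A1)-PACKED», brick (B3) PART 2a
# «A1-PACKED-TORUS — THE FIRST-ORDER WARD LETTERS AT THE TORUS RESPONSES» (`A1-PACKED-SPEC.md` v0.4 §9): **ON EVERY COARSE TORUS THE ONE-SIDED WARD-L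
# LETTERS `aₛ bₛ aₜ bₜ` OF `KCombineCovColourTorus.identity_array_currency_cov_What0_stripped` HOLD FOR RESPONSE-PACKED JETS**, the responses being the packed
# columns of the torus comb-gauged KKT inverse `M_T⁻¹` at ANY non-field source — from the per-bond off-shell Noether jets [P1] (DISPLAYED) by K-TA4W
# `WardJetsFromNoether.ward₁`, its source hypothesis DISCHARGED by `WardJetsCombSources.field_rows_packed_col` over the torus letters `K̂ᵀŴ₀ = 0`, `Q̂Ŵ₀ = 0`,
# `τ_TŴ₀ = 1` (TA1∕TB1).

HONEST DEPENDENCY (cell records, verbatim): «continuum YM on T⁴ ⇐ BetaPertH ∧ nine spine estimates (0/9 proved); BetaPertH ⇐ (D1) ∧ (D4) ∧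
CAP+tail; G-an2-4 gates asym, D1 and NE2/3/4.»  HONEST FRAMING (cell contract, verbatim): «discharging `BetaPertH` makes Bałaban's UV stability
UNCONDITIONAL — a real constructive-QFT result; it is NOT the continuum limit and NOT the Clay problem.»  THIS MODULE DISCHARGES NOTHING of (K),
of D1 or of the wall: [folklore] composition BY NAME of `WardJetsFromNoether.ward₁`, `WardJetsCombSources.field_rows_packed_col`, `TorusCombKKT.isUnit_det_MT`,
`TorusGaugeBasis.Khat_mul_What0 ∕ Qhat_mul_What0 ∕ tauT_mul_What0`, `TorusGaugeBasisTranspose.Khat_transpose_mul_What0`.  The per-bond jets [P1] are DISPLAYED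
(the literal's table-level Ward identities — `WardJetsFromNoether.P1_of_congruence` derives them from the congruence letters [C1]).  No definition, no
`def … : Prop`, nothing cited, 0 sorry.  0 root-level binders of row D1 discharged; (K) NOT closed; NOT D1, NOT `BetaPertH`, NOT continuum, NOT Clay.

ABSOLUTE RULE (cell charter, verbatim): «No internally-minted statement may enter as a cited fact. Every hypothesis is either kernel-proved in this
package or a verbatim quotation of a PUBLISHED theorem with page reference. The manuscript(s) under audit are NOT citable for their own disputed
steps — they are the thing under adjudication; programme-internal (2001/route/tribunal) claims are never citable.»

CONTENT (torus `n, p`, root `r ∈ box (d+1) n`; `M_T := kkt K̂ (fromRows Q̂ τ_T)` on `I ⊕ (J ⊕ CombRows)`; a non-field source `b : J ⊕ CombRows`; the PACKED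
response `r_b k := M_T⁻¹ (Sum.map id inl k) (inr b)` on `k : I ⊕ J`; per-bond data `K₁ k`, `Q₁ k`, generator jets `x₁ k` with [P1]).
* §1 `MT_mul_inv` (`M_T·M_T⁻¹ = 1`), **`comb_response_eq_zero`** (the comb-multiplier components of every response to a non-field source VANISH),
  **`packed_ward₁`** (`(Σ_k r_b k • K₁ k)·Ŵ₀ + K̂·(Σ_k r_b k • x₁ k) = 0 ∧ (Σ_k r_b k • Q₁ k)·Ŵ₀ + Q̂·(Σ_k r_b k • x₁ k) = 0`).
* §2 **`packed_ward₁_field`**: when the tables and generator jets at the coarse-multiplier indices vanish (`K₁ (inr j) = 0`, `Q₁ (inr j) = 0`, `x₁ (inr j) = 0` — the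
  literal differentiates in fine-bond variables only), the sums run over the fine bonds `k : I d n p` with the responses `M_T⁻¹ (inl k) (inr b)` of (B4b) ∕ (B3) PART 1:
  the letters `aₛ`, `bₛ` (source `b = inl (ȳ₀, μ)`) and `aₜ`, `bₜ` (`b = inl (ȳ_z, ν)`) verbatim, with `kₛ := Σ_k rₛ k • K₁ (inl k)`, `qₛ := …`, `wₛ := Σ_k rₛ k • x₁ (inl k)`.
NOT HERE: the second-order letters `aₛₜ bₛₜ` (PART 2b: `ward₂_even_of_lift` ∕ `field_rows_second`), the identification of `K₁ (inl k)`, `Q₁ (inl k)` with the blocks of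
`(arr s (S κ′_k ŵ_k))ˆ` (PART 3, with PART 1 + `WardJetsFromNoether.sum_smul_kkt`).
Unit `b2b-balaban-beta-d1-p2` (road owner, gen 17), 2026-08-22.
-/

noncomputable section

namespace Summit.QuantumFields.BalabanUV.Beta.D1BFx.PackedWardLettersFirst

open Matrix
open scoped BigOperators
open Literature.Probability.LatticeModels (TorusSite)
open Literature.MathematicalPhysics.QuantumFieldTheory.Balaban1983to89
open Literature.MathematicalPhysics.QuantumFieldTheory.Balaban1983to89.Beta
open Literature.MathematicalPhysics.QuantumFieldTheory.Balaban1983to89.Beta.Composition (kkt)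
open AffineAveraging (box toSite)
open Summit.QuantumFields.BalabanUV.Beta.D1BFx.TorusCombKKT (I J CombRows tauT Khat Qhat isUnit_det_MT)
open Summit.QuantumFields.BalabanUV.Beta.D1BFx.TorusGaugeBasis (What0 tauT_mul_What0 Khat_mul_What0 Qhat_mul_What0)
open Summit.QuantumFields.BalabanUV.Beta.D1BFx.TorusGaugeBasisTranspose (Khat_transpose_mul_What0)
open Summit.QuantumFields.BalabanUV.Beta.D1BFx.WardJetsFromNoether (oslot ward₁)
open Summit.QuantumFields.BalabanUV.Beta.D1BFx.WardJetsCombSources (field_rows_packed_col)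

variable {d : ℕ} {n : ℕ} [NeZero n] {r : Fin (d + 1) → ℕ} (hr : r ∈ box (d + 1) n) (p : ℕ) [NeZero p]
include hr

/-! ## §1 The packed Ward letters at a response to any non-field source -/

/-- [folklore] `M_T · M_T⁻¹ = 1` on every coarse torus (TB1 `isUnit_det_MT`). -/
theorem MT_mul_inv :
    kkt (Khat (d := d) n p) (Matrix.fromRows (Qhat (d := d) n p) (tauT (toSite r) n p))
        * (kkt (Khat (d := d) n p) (Matrix.fromRows (Qhat (d := d) n p) (tauT (toSite r) n p)))⁻¹ = 1 :=
  Matrix.mul_nonsing_inv _ (isUnit_det_MT (d := d) hr p)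

/-- [folklore] **THE COMB MULTIPLIERS OF A RESPONSE TO A NON-FIELD SOURCE VANISH**: `M_T⁻¹ (inr (inr q)) (inr b) = 0` for every comb row `q` and every
`b : J ⊕ CombRows` (`WardJetsCombSources.field_rows_packed_col` over `K̂ᵀŴ₀ = 0`, `Q̂Ŵ₀ = 0`, `τ_TŴ₀ = 1`). -/
theorem comb_response_eq_zero (b : J d p ⊕ CombRows (toSite r) n p) (q : CombRows (toSite r) n p) :
    (kkt (Khat (d := d) n p) (Matrix.fromRows (Qhat (d := d) n p) (tauT (toSite r) n p)))⁻¹ (Sum.inr (Sum.inr q)) (Sum.inr b) = 0 :=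
  (field_rows_packed_col (Khat (d := d) n p) (Qhat (d := d) n p) (tauT (toSite r) n p) (What0 r n p) (Khat_transpose_mul_What0 r n p hr)
    (Qhat_mul_What0 r n p hr) (by rw [tauT_mul_What0 r n p, Matrix.det_one]; exact isUnit_one) _ (MT_mul_inv hr p) b).1 q

/-- [folklore] **(B3) PART 2a — THE PACKED FIRST-ORDER WARD LETTERS.**  For per-bond data `K₁ k`, `Q₁ k` and generator jets `x₁ k` (`k : I ⊕ J`) satisfying the
off-shell Noether jets [P1] (DISPLAYED), and ANY non-field source `b`, the jets packed with the response `r_b k := M_T⁻¹ (Sum.map id inl k) (inr b)` satisfy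
`(Σ_k r_b k • K₁ k)·Ŵ₀ + K̂·(Σ_k r_b k • x₁ k) = 0` and `(Σ_k r_b k • Q₁ k)·Ŵ₀ + Q̂·(Σ_k r_b k • x₁ k) = 0` (`ward₁`; source hypothesis by `field_rows_packed_col`). -/
theorem packed_ward₁ (K₁ : I d n p ⊕ J d p → Matrix (I d n p) (I d n p) ℝ) (Q₁ : I d n p ⊕ J d p → Matrix (J d p) (I d n p) ℝ)
    (x₁ : I d n p ⊕ J d p → Matrix (I d n p) (CombRows (toSite r) n p) ℝ)
    (hP1 : ∀ k, kkt (K₁ k) (Q₁ k) * Matrix.fromRows (What0 r n p) (0 : Matrix (J d p) (CombRows (toSite r) n p) ℝ)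
        + kkt (Khat (d := d) n p) (Qhat (d := d) n p) * Matrix.fromRows (x₁ k) (0 : Matrix (J d p) (CombRows (toSite r) n p) ℝ)
        + oslot (fun j => Matrix.fromRows (x₁ j) (0 : Matrix (J d p) (CombRows (toSite r) n p) ℝ)) (fun i => kkt (Khat (d := d) n p) (Qhat (d := d) n p) i k)
      = 0)
    (b : J d p ⊕ CombRows (toSite r) n p) :
    (∑ k, (kkt (Khat (d := d) n p) (Matrix.fromRows (Qhat (d := d) n p) (tauT (toSite r) n p)))⁻¹ (Sum.map id Sum.inl k) (Sum.inr b) • K₁ k) * What0 r n p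
        + Khat (d := d) n p * (∑ k, (kkt (Khat (d := d) n p) (Matrix.fromRows (Qhat (d := d) n p) (tauT (toSite r) n p)))⁻¹ (Sum.map id Sum.inl k) (Sum.inr b) • x₁ k) = 0
      ∧ (∑ k, (kkt (Khat (d := d) n p) (Matrix.fromRows (Qhat (d := d) n p) (tauT (toSite r) n p)))⁻¹ (Sum.map id Sum.inl k) (Sum.inr b) • Q₁ k) * What0 r n p
        + Qhat (d := d) n p * (∑ k, (kkt (Khat (d := d) n p) (Matrix.fromRows (Qhat (d := d) n p) (tauT (toSite r) n p)))⁻¹ (Sum.map id Sum.inl k) (Sum.inr b) • x₁ k) = 0 :=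
  ward₁ _ _ K₁ Q₁ _ x₁ hP1 _
    (field_rows_packed_col (Khat (d := d) n p) (Qhat (d := d) n p) (tauT (toSite r) n p) (What0 r n p) (Khat_transpose_mul_What0 r n p hr)
      (Qhat_mul_What0 r n p hr) (by rw [tauT_mul_What0 r n p, Matrix.det_one]; exact isUnit_one) _ (MT_mul_inv hr p) b).2

/-! ## §2 Tables at the fine bonds only: the letters `a•`, `b•` of the stripped identity -/

/-- [folklore] **THE LETTERS `aₛ bₛ` (∕ `aₜ bₜ`) FOR FINE-BOND TABLES.**  When `K₁`, `Q₁`, `x₁` vanish at the coarse-multiplier indices (the literal differentiates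
in the fine-bond variables only), the packed jets are the `I d n p`-sums with the responses `M_T⁻¹ (inl k) (inr b)` of (B4b) ∕ (B3) PART 1, and
`(Σ_{k : I} r k • K₁ (inl k))·Ŵ₀ + K̂·(Σ_{k : I} r k • x₁ (inl k)) = 0 ∧ (Σ_{k : I} r k • Q₁ (inl k))·Ŵ₀ + Q̂·(Σ_{k : I} r k • x₁ (inl k)) = 0`. -/
theorem packed_ward₁_field (K₁ : I d n p ⊕ J d p → Matrix (I d n p) (I d n p) ℝ) (Q₁ : I d n p ⊕ J d p → Matrix (J d p) (I d n p) ℝ)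
    (x₁ : I d n p ⊕ J d p → Matrix (I d n p) (CombRows (toSite r) n p) ℝ)
    (hP1 : ∀ k, kkt (K₁ k) (Q₁ k) * Matrix.fromRows (What0 r n p) (0 : Matrix (J d p) (CombRows (toSite r) n p) ℝ)
        + kkt (Khat (d := d) n p) (Qhat (d := d) n p) * Matrix.fromRows (x₁ k) (0 : Matrix (J d p) (CombRows (toSite r) n p) ℝ)
        + oslot (fun j => Matrix.fromRows (x₁ j) (0 : Matrix (J d p) (CombRows (toSite r) n p) ℝ)) (fun i => kkt (Khat (d := d) n p) (Qhat (d := d) n p) i k)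
      = 0)
    (hK : ∀ j, K₁ (Sum.inr j) = 0) (hQ : ∀ j, Q₁ (Sum.inr j) = 0) (hx : ∀ j, x₁ (Sum.inr j) = 0) (b : J d p ⊕ CombRows (toSite r) n p) :
    (∑ k : I d n p, (kkt (Khat (d := d) n p) (Matrix.fromRows (Qhat (d := d) n p) (tauT (toSite r) n p)))⁻¹ (Sum.inl k) (Sum.inr b) • K₁ (Sum.inl k))
          * What0 r n p
        + Khat (d := d) n p * (∑ k : I d n p,
            (kkt (Khat (d := d) n p) (Matrix.fromRows (Qhat (d := d) n p) (tauT (toSite r) n p)))⁻¹ (Sum.inl k) (Sum.inr b) • x₁ (Sum.inl k)) = 0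
      ∧ (∑ k : I d n p, (kkt (Khat (d := d) n p) (Matrix.fromRows (Qhat (d := d) n p) (tauT (toSite r) n p)))⁻¹ (Sum.inl k) (Sum.inr b) • Q₁ (Sum.inl k))
          * What0 r n p
        + Qhat (d := d) n p * (∑ k : I d n p,
            (kkt (Khat (d := d) n p) (Matrix.fromRows (Qhat (d := d) n p) (tauT (toSite r) n p)))⁻¹ (Sum.inl k) (Sum.inr b) • x₁ (Sum.inl k)) = 0 := by
  have h := packed_ward₁ hr p K₁ Q₁ x₁ hP1 b
  simp only [Fintype.sum_sum_type, Sum.map_inl, Sum.map_inr, id, hK, hQ, hx, smul_zero, Finset.sum_const_zero, add_zero] at h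
  exact h

end Summit.QuantumFields.BalabanUV.Beta.D1BFx.PackedWardLettersFirst

end
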